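import Summits.BirchSwinnertonDyer.BirchSwinnertonDyer.Theorems.ByReductionTypeAtTwoOrdKatoHalfAtTwoIsoColemanMuFreeValue
import Summits.BirchSwinnertonDyer.BirchSwinnertonDyer.Theorems.ByReductionTypeAtTwoOrdKatoHalfAtTwoIsoPosDiscEpsilon
import Literature.NumberTheory.EllipticCurves.Kato2004.LocalIwasawaCohomologyOrdinaryQuotient
import HarnessLib

/-!
# Route ByReductionTypeAtTwo, crux `OrdKatoHalfAtTwoIso` (stmt-BirchSwinnertonDyer-19573), line `steinberg-fibre-at-two`,
# F1 slot (child stmt-BirchSwinnertonDyer-24097): the KERNEL CLAUSE of the memo stubs W2⁻ / W2⁺ leaves the memo tier —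
# F1μι⁻ and P⁺ BY NAME from TWO Literature facts read at `2` (Tate duality along the tower, p723619; the ordinary-kernel
# functional, p727215 — both PRINT-COMPOSITE at every `p`) and ONE value-only memo text per cell: «every NORMALISED
# ordinary-kernel functional takes a value outside `(2)` at `loc₂` of some (genuine) class»

Seat `cruxlead-stmt-BirchSwinnertonDyer-19573-w3` g5 (prover WIDTH under the LEAD `cruxlead-19573`; HOME `run/shared/lean/pub/bsd-2adic/`;
`--supports` stmt-BirchSwinnertonDyer-24097). THEOREMS ONLY (no definition, no named fact, no `sorry`, no instance). HONEST FRAMING (cell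
bsd-2adic): BSD is not proved by any of this; F1μι⁻, P⁺, the children and the crux are NOT proved here; the value texts V♭⁻ / V♭⁺ below are
displayed HYPOTHESES (memo tier: a READING of Kato Thm 12.6 / 16.6 (2) at `2` with the lead's period line F-27a — the explicit reciprocity
law survives only as «the Coleman value of a genuine zeta class is `μ`-free»), NOT definitions and NOT Literature facts.

WHY. The registered v21 memo stubs W2∓ = «∃ `col` with `ker col ≤ range(J′ → J)` ∧ value clause». The width seat's p727025 showed
W2∓ ⟺ V∓ = «∃ `col` with `ker col ≤ range(J′ → J)` and a (genuine) class with `col (loc ·) ∉ (2)`» in the kernel. The EXISTENCE half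
— an ordinary-kernel functional `col : 𝐇¹_{loc,Γ}(T_pW) → Λ` with `ker col = 𝐇¹_{loc,Γ}(F⁺T)` EXACTLY and some value outside `(p)` —
is now the Literature fact `Kato2004.exists_ordinaryKernelFunctional` (every `p`: Perrin-Riou's torsion formula for `𝐇¹_Iw(T/F⁺T)`,
`H⁰ = 0` for the unit-root quotient, ranks `2 ∣ 1 ∣ 1`, linear algebra over the domain `Λ`; NOT Coleman's (17.12.1), whose `p = 2` form
was the locus flagged in w3 g4's W2-LOCUS note — that locus LEAVES the line). What remains memo-grade is the value statement alone, here
in the ∀-form over normalised functionals (V♭): any two normalised ordinary-kernel functionals differ by a factor `λ ∈ Λ ∖ (2)` once a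
finite-cokernel one exists (reflexive hull over the regular local ring `Λ`; NOT asserted, not used), so V♭ is the choice-free phrasing of V.

* §1 `muFreeValue_negDisc_of_ordKernel` / `muFreeValue_posDisc_of_ordKernel` — fact@2 + V♭∓ ⇒ V∓ (instantiate the fact's functional).
* §2 doors BY NAME: `zetaColemanMuIotaNegDiscAtTwo_of_tateDuality_of_ordKernel_of_muFreeValue` (F1μι⁻ = conjunct 1 of child 24097),
  `colemanMuSpanFreeIotaPosDiscAtTwo_of_tateDuality_of_ordKernel_of_muFreeValue` (P⁺),
  `ordKatoFineZetaAtTwoResidue_of_tateDuality_of_ordKernel_of_muFreeValues_of_conjA_of_print` (child 24097 BY NAME over the two facts, V♭⁻,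
  V♭⁺, Q⁺ = `FineSelmerConjATwoOrdPosDisc`, Abbes–Ullmo and Kato 17.4 (1)(2) at `2`, through the lead g6's (ε) door).

References: [Kato2004Asterisque] Thm 12.6 (p. 222), Thm 16.6 (2) (p. 271), Prop 17.11 (p. 277), §17.13 (pp. 279–280); [PerrinRiou2000JAMS] §1.1;
[GreenbergLNM1716] §2 Lemma 2.3, Conj. 1.11; [MilneADT2006] I Cor. 2.3, Thm. 4.10; tree p720644, p723623, p723619, p727025, p727215.
-/

set_option autoImplicit false
set_option linter.dupNamespace false

noncomputable section

open scoped Classical MatrixGroups ModularForm NumberField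
open CongruenceSubgroup WeierstrassCurve Field IsDedekindDomain NumberField
open Literature.NumberTheory.GaloisRepresentations
open Literature.NumberTheory.GaloisCohomology
open Literature.NumberTheory.EllipticCurves Literature.NumberTheory.EllipticCurves.ModularForms
  Literature.NumberTheory.EllipticCurves.GreenbergSelmer
open Literature.NumberTheory.EllipticCurves.Kato2004
  Literature.NumberTheory.EllipticCurves.Kato2004.EulerSystemValues
open Literature.NumberTheory.EllipticCurves.IwasawaDual
open Literature.NumberTheory.EllipticCurves.Rank1Residual
open Literature.NumberTheory.EllipticCurves.Greenberg1999
open Summit.BirchSwinnertonDyer.Rank1Residual Summit.BirchSwinnertonDyer.Rank1Residual.X5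
open Summit.BirchSwinnertonDyer.BirchSwinnertonDyer.Theses.ByReductionTypeAtTwo

namespace Summit.BirchSwinnertonDyer.BirchSwinnertonDyer.Theorems.SteinbergFibreAtTwo

/-! ## §1 The ordinary-kernel functional (Literature fact at `2`) + the ∀-value text ⇒ the ∃-value text of p727025 -/

/-- **V♭⁻ ⟹ V⁻ over the fact** (`Δ < 0`, genuine class): the Literature fact `Kato2004.exists_ordinaryKernelFunctional` read at `2` hands,
for every cell datum and all carriers, a NORMALISED functional `col : J.H → Λ` with `ker col = range(J′ → J)` and a value outside `(2)`; the
displayed memo text V♭⁻ («every such functional takes a value outside `(2)` at `loc₂ g` for some GENUINE Euler-system class `g`») then gives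
the ∃-text V⁻ of `colemanERL_negDisc_two_of_muFreeValue` (p727025). CONDITIONAL; nothing closed.
[cite: PerrinRiou2000JAMS, §1.1 (p. 537)] [cite: Kato2004Asterisque, §12.2 (12.2.3) (p. 220), Thm 12.6 (p. 222), Thm 16.6 (2) (p. 271), Prop 17.11 (p. 277)] -/
theorem muFreeValue_negDisc_of_ordKernel (hOK : exists_ordinaryKernelFunctional)
    (hVflat : ∀ (W : WeierstrassCurve ℚ) [W.IsElliptic] [W.IsGloballyMinimal]
      [ContinuousSMul ℤ_[2] (W.tateModule 2)] [Module.Free ℤ_[2] (W.tateModule 2)] [Module.Finite ℤ_[2] (W.tateModule 2)]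
      {N : ℕ} [NeZero N] (f : CuspForm (Gamma0 N) 2)
      (κ : ZpExtension ℚ 2) (γ : absoluteGaloisGroup ℚ) (hκ : κ.IsCyclotomic) (hγ : κ.IsTopGenerator γ),
      W.Δ < 0 → IsOrdinaryAt W 2 → W.HasSurjectiveModNGaloisRep 2 → IsCyclotomicVariable 2 γ → IsNewformOf W f →
      ∀ (v₂ : HeightOneSpectrum (𝓞 ℚ)) (_ : ((2 : ℕ) : 𝓞 ℚ) ∈ v₂.asIdeal)
        (γᵥ : absoluteGaloisGroup (v₂.adicCompletion ℚ))
        (hsurj : Function.Surjective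
          (κ.toContinuousMonoidHom.comp (resGalOfEmb (closureEmb (K := ℚ) (v₂.adicCompletion ℚ)))))
        (hγᵥ : κ.IsTopGenerator (resGalOfEmb (closureEmb (K := ℚ) (v₂.adicCompletion ℚ)) γᵥ))
        (I : IwasawaH1Data W 2 κ γ) (J : LocalIwasawaH1Data κ v₂ ((tateRep W 2).toLocal v₂) γᵥ)
        (J' : LocalIwasawaH1Data κ v₂ (tateLocalOrdinaryRep W 2 v₂) γᵥ)
        (col : J.H →ₗ[IwasawaAlgebra 2] IwasawaAlgebra 2),
        (∀ x : J.H, col x = 0 ↔ x ∈ LinearMap.range (J'.ordinaryInclusion J)) →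
        (∃ x : J.H, col x ∉ IwasawaAlgebra.augIdealP 2) →
        ∃ g : I.H, IsEulerSystemClassTwo W hκ I g ∧ col (I.loc J hsurj hγ hγᵥ g) ∉ IwasawaAlgebra.augIdealP 2) :
    ∀ (W : WeierstrassCurve ℚ) [W.IsElliptic] [W.IsGloballyMinimal]
      [ContinuousSMul ℤ_[2] (W.tateModule 2)] [Module.Free ℤ_[2] (W.tateModule 2)] [Module.Finite ℤ_[2] (W.tateModule 2)]
      {N : ℕ} [NeZero N] (f : CuspForm (Gamma0 N) 2)
      (κ : ZpExtension ℚ 2) (γ : absoluteGaloisGroup ℚ) (hκ : κ.IsCyclotomic) (hγ : κ.IsTopGenerator γ),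
      W.Δ < 0 → IsOrdinaryAt W 2 → W.HasSurjectiveModNGaloisRep 2 → IsCyclotomicVariable 2 γ → IsNewformOf W f →
      ∀ (v₂ : HeightOneSpectrum (𝓞 ℚ)) (_ : ((2 : ℕ) : 𝓞 ℚ) ∈ v₂.asIdeal)
        (γᵥ : absoluteGaloisGroup (v₂.adicCompletion ℚ))
        (hsurj : Function.Surjective
          (κ.toContinuousMonoidHom.comp (resGalOfEmb (closureEmb (K := ℚ) (v₂.adicCompletion ℚ)))))
        (hγᵥ : κ.IsTopGenerator (resGalOfEmb (closureEmb (K := ℚ) (v₂.adicCompletion ℚ)) γᵥ))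
        (I : IwasawaH1Data W 2 κ γ) (J : LocalIwasawaH1Data κ v₂ ((tateRep W 2).toLocal v₂) γᵥ)
        (J' : LocalIwasawaH1Data κ v₂ (tateLocalOrdinaryRep W 2 v₂) γᵥ),
      ∃ col : J.H →ₗ[IwasawaAlgebra 2] IwasawaAlgebra 2,
        (∀ x : J.H, col x = 0 → x ∈ LinearMap.range (J'.ordinaryInclusion J)) ∧
        ∃ g : I.H, IsEulerSystemClassTwo W hκ I g ∧ col (I.loc J hsurj hγ hγᵥ g) ∉ IwasawaAlgebra.augIdealP 2 := by
  intro W _ _ _ _ _ N _ f κ γ hκ hγ hΔ hord h2 hγ' hf v₂ hv₂ γᵥ hsurj hγᵥ I J J'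
  obtain ⟨col, hker, hnorm⟩ := hOK 2 W κ v₂ γᵥ hκ hv₂ hord hγᵥ J J'
  obtain ⟨g, hg, hval⟩ := hVflat W f κ γ hκ hγ hΔ hord h2 hγ' hf v₂ hv₂ γᵥ hsurj hγᵥ I J J' col hker hnorm
  exact ⟨col, fun x hx => (hker x).mp hx, g, hg, hval⟩

/-- **V♭⁺ ⟹ V⁺ over the fact** (`0 < Δ`, one global class): the same instantiation for the `0 < Δ` cell — the fact's normalised
ordinary-kernel functional and the displayed memo text V♭⁺ («every such functional takes a value outside `(2)` at `loc₂ y` for some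
`y ∈ 𝐇¹_Γ`») give the ∃-text V⁺ of `colemanHalf_posDisc_two_of_muFreeValue` (p727025). CONDITIONAL; nothing closed.
[cite: PerrinRiou2000JAMS, §1.1 (p. 537)] [cite: Kato2004Asterisque, §12.2 (12.2.3) (p. 220), Thm 12.5 (1) (p. 221), Prop 17.11 (p. 277)]
[cite: GreenbergLNM1716, Conj. 1.11 (p. 64) (shape)] -/
theorem muFreeValue_posDisc_of_ordKernel (hOK : exists_ordinaryKernelFunctional)
    (hVflat : ∀ (W : WeierstrassCurve ℚ) [W.IsElliptic] [W.IsGloballyMinimal]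
      [ContinuousSMul ℤ_[2] (W.tateModule 2)] [Module.Free ℤ_[2] (W.tateModule 2)] [Module.Finite ℤ_[2] (W.tateModule 2)]
      {N : ℕ} [NeZero N] (f : CuspForm (Gamma0 N) 2)
      (κ : ZpExtension ℚ 2) (γ : absoluteGaloisGroup ℚ) (hκ : κ.IsCyclotomic) (hγ : κ.IsTopGenerator γ),
      0 < W.Δ → IsOrdinaryAt W 2 → W.HasSurjectiveModNGaloisRep 2 → IsCyclotomicVariable 2 γ → IsNewformOf W f →
      ∀ (v₂ : HeightOneSpectrum (𝓞 ℚ)) (_ : ((2 : ℕ) : 𝓞 ℚ) ∈ v₂.asIdeal)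
        (γᵥ : absoluteGaloisGroup (v₂.adicCompletion ℚ))
        (hsurj : Function.Surjective
          (κ.toContinuousMonoidHom.comp (resGalOfEmb (closureEmb (K := ℚ) (v₂.adicCompletion ℚ)))))
        (hγᵥ : κ.IsTopGenerator (resGalOfEmb (closureEmb (K := ℚ) (v₂.adicCompletion ℚ)) γᵥ))
        (I : IwasawaH1Data W 2 κ γ) (J : LocalIwasawaH1Data κ v₂ ((tateRep W 2).toLocal v₂) γᵥ)
        (J' : LocalIwasawaH1Data κ v₂ (tateLocalOrdinaryRep W 2 v₂) γᵥ)
        (col : J.H →ₗ[IwasawaAlgebra 2] IwasawaAlgebra 2),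
        (∀ x : J.H, col x = 0 ↔ x ∈ LinearMap.range (J'.ordinaryInclusion J)) →
        (∃ x : J.H, col x ∉ IwasawaAlgebra.augIdealP 2) →
        ∃ y : I.H, col (I.loc J hsurj hγ hγᵥ y) ∉ IwasawaAlgebra.augIdealP 2) :
    ∀ (W : WeierstrassCurve ℚ) [W.IsElliptic] [W.IsGloballyMinimal]
      [ContinuousSMul ℤ_[2] (W.tateModule 2)] [Module.Free ℤ_[2] (W.tateModule 2)] [Module.Finite ℤ_[2] (W.tateModule 2)]
      {N : ℕ} [NeZero N] (f : CuspForm (Gamma0 N) 2)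
      (κ : ZpExtension ℚ 2) (γ : absoluteGaloisGroup ℚ) (hκ : κ.IsCyclotomic) (hγ : κ.IsTopGenerator γ),
      0 < W.Δ → IsOrdinaryAt W 2 → W.HasSurjectiveModNGaloisRep 2 → IsCyclotomicVariable 2 γ → IsNewformOf W f →
      ∀ (v₂ : HeightOneSpectrum (𝓞 ℚ)) (_ : ((2 : ℕ) : 𝓞 ℚ) ∈ v₂.asIdeal)
        (γᵥ : absoluteGaloisGroup (v₂.adicCompletion ℚ))
        (hsurj : Function.Surjective
          (κ.toContinuousMonoidHom.comp (resGalOfEmb (closureEmb (K := ℚ) (v₂.adicCompletion ℚ)))))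
        (hγᵥ : κ.IsTopGenerator (resGalOfEmb (closureEmb (K := ℚ) (v₂.adicCompletion ℚ)) γᵥ))
        (I : IwasawaH1Data W 2 κ γ) (J : LocalIwasawaH1Data κ v₂ ((tateRep W 2).toLocal v₂) γᵥ)
        (J' : LocalIwasawaH1Data κ v₂ (tateLocalOrdinaryRep W 2 v₂) γᵥ),
      ∃ col : J.H →ₗ[IwasawaAlgebra 2] IwasawaAlgebra 2,
        (∀ x : J.H, col x = 0 → x ∈ LinearMap.range (J'.ordinaryInclusion J)) ∧
        ∃ y : I.H, col (I.loc J hsurj hγ hγᵥ y) ∉ IwasawaAlgebra.augIdealP 2 := by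
  intro W _ _ _ _ _ N _ f κ γ hκ hγ hΔ hord h2 hγ' hf v₂ hv₂ γᵥ hsurj hγᵥ I J J'
  obtain ⟨col, hker, hnorm⟩ := hOK 2 W κ v₂ γᵥ hκ hv₂ hord hγᵥ J J'
  obtain ⟨y, hval⟩ := hVflat W f κ γ hκ hγ hΔ hord h2 hγ' hf v₂ hv₂ γᵥ hsurj hγᵥ I J J' col hker hnorm
  exact ⟨col, fun x hx => (hker x).mp hx, y, hval⟩

/-! ## §2 Doors BY NAME: F1μι⁻, P⁺ and the PAIR child 24097 from the two Literature facts, the value texts and Q⁺ + print -/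

/-- **F1μι⁻ = `ZetaColemanMuIotaNegDiscAtTwo` (conjunct 1 of child 24097) BY NAME from the TWO Literature facts read at `2`** (Tate duality
along the tower, `Kato2004.exists_lambdaAdicLocalTatePairing_selmer_orthogonal`, p723619; the ordinary-kernel functional,
`Kato2004.exists_ordinaryKernelFunctional`, p727215 — both PRINT-COMPOSITE at every `p`) and ONE memo text V♭⁻ — through p727025 and w3 g3's
p720644. CONDITIONAL; nothing closed. [cite: MilneADT2006, Ch. I Cor. 2.3 and Thm. 4.10] [cite: PerrinRiou2000JAMS, §1.1 (p. 537)]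
[cite: Kato2004Asterisque, Thm 12.6 (p. 222), Thm 16.6 (2) (p. 271), §17.13 (pp. 279–280)] -/
theorem zetaColemanMuIotaNegDiscAtTwo_of_tateDuality_of_ordKernel_of_muFreeValue
    (hPT : exists_lambdaAdicLocalTatePairing_selmer_orthogonal) (hOK : exists_ordinaryKernelFunctional)
    (hVflat : ∀ (W : WeierstrassCurve ℚ) [W.IsElliptic] [W.IsGloballyMinimal]
      [ContinuousSMul ℤ_[2] (W.tateModule 2)] [Module.Free ℤ_[2] (W.tateModule 2)] [Module.Finite ℤ_[2] (W.tateModule 2)]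
      {N : ℕ} [NeZero N] (f : CuspForm (Gamma0 N) 2)
      (κ : ZpExtension ℚ 2) (γ : absoluteGaloisGroup ℚ) (hκ : κ.IsCyclotomic) (hγ : κ.IsTopGenerator γ),
      W.Δ < 0 → IsOrdinaryAt W 2 → W.HasSurjectiveModNGaloisRep 2 → IsCyclotomicVariable 2 γ → IsNewformOf W f →
      ∀ (v₂ : HeightOneSpectrum (𝓞 ℚ)) (_ : ((2 : ℕ) : 𝓞 ℚ) ∈ v₂.asIdeal)
        (γᵥ : absoluteGaloisGroup (v₂.adicCompletion ℚ))
        (hsurj : Function.Surjective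
          (κ.toContinuousMonoidHom.comp (resGalOfEmb (closureEmb (K := ℚ) (v₂.adicCompletion ℚ)))))
        (hγᵥ : κ.IsTopGenerator (resGalOfEmb (closureEmb (K := ℚ) (v₂.adicCompletion ℚ)) γᵥ))
        (I : IwasawaH1Data W 2 κ γ) (J : LocalIwasawaH1Data κ v₂ ((tateRep W 2).toLocal v₂) γᵥ)
        (J' : LocalIwasawaH1Data κ v₂ (tateLocalOrdinaryRep W 2 v₂) γᵥ)
        (col : J.H →ₗ[IwasawaAlgebra 2] IwasawaAlgebra 2),
        (∀ x : J.H, col x = 0 ↔ x ∈ LinearMap.range (J'.ordinaryInclusion J)) →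
        (∃ x : J.H, col x ∉ IwasawaAlgebra.augIdealP 2) →
        ∃ g : I.H, IsEulerSystemClassTwo W hκ I g ∧ col (I.loc J hsurj hγ hγᵥ g) ∉ IwasawaAlgebra.augIdealP 2) :
    ZetaColemanMuIotaNegDiscAtTwo :=
  zetaColemanMuIotaNegDiscAtTwo_of_tateDuality_of_muFreeValue hPT (muFreeValue_negDisc_of_ordKernel hOK hVflat)

/-- **P⁺ = `ColemanMuSpanFreeIotaPosDiscAtTwo` BY NAME from the two Literature facts read at `2` and ONE memo text V♭⁺** — through p727025 and
the lead g9's p723623. CONDITIONAL; nothing closed. [cite: MilneADT2006, Ch. I Cor. 2.3 and Thm. 4.10] [cite: PerrinRiou2000JAMS, §1.1 (p. 537)]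
[cite: Kato2004Asterisque, Thm 12.5 (1) (p. 221), Thm 16.6 (2) (p. 271), §17.13 (pp. 279–280)] [cite: GreenbergLNM1716, Conj. 1.11 (p. 64) (shape)] -/
theorem colemanMuSpanFreeIotaPosDiscAtTwo_of_tateDuality_of_ordKernel_of_muFreeValue
    (hPT : exists_lambdaAdicLocalTatePairing_selmer_orthogonal) (hOK : exists_ordinaryKernelFunctional)
    (hVflat : ∀ (W : WeierstrassCurve ℚ) [W.IsElliptic] [W.IsGloballyMinimal]
      [ContinuousSMul ℤ_[2] (W.tateModule 2)] [Module.Free ℤ_[2] (W.tateModule 2)] [Module.Finite ℤ_[2] (W.tateModule 2)]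
      {N : ℕ} [NeZero N] (f : CuspForm (Gamma0 N) 2)
      (κ : ZpExtension ℚ 2) (γ : absoluteGaloisGroup ℚ) (hκ : κ.IsCyclotomic) (hγ : κ.IsTopGenerator γ),
      0 < W.Δ → IsOrdinaryAt W 2 → W.HasSurjectiveModNGaloisRep 2 → IsCyclotomicVariable 2 γ → IsNewformOf W f →
      ∀ (v₂ : HeightOneSpectrum (𝓞 ℚ)) (_ : ((2 : ℕ) : 𝓞 ℚ) ∈ v₂.asIdeal)
        (γᵥ : absoluteGaloisGroup (v₂.adicCompletion ℚ))
        (hsurj : Function.Surjective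
          (κ.toContinuousMonoidHom.comp (resGalOfEmb (closureEmb (K := ℚ) (v₂.adicCompletion ℚ)))))
        (hγᵥ : κ.IsTopGenerator (resGalOfEmb (closureEmb (K := ℚ) (v₂.adicCompletion ℚ)) γᵥ))
        (I : IwasawaH1Data W 2 κ γ) (J : LocalIwasawaH1Data κ v₂ ((tateRep W 2).toLocal v₂) γᵥ)
        (J' : LocalIwasawaH1Data κ v₂ (tateLocalOrdinaryRep W 2 v₂) γᵥ)
        (col : J.H →ₗ[IwasawaAlgebra 2] IwasawaAlgebra 2),
        (∀ x : J.H, col x = 0 ↔ x ∈ LinearMap.range (J'.ordinaryInclusion J)) →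
        (∃ x : J.H, col x ∉ IwasawaAlgebra.augIdealP 2) →
        ∃ y : I.H, col (I.loc J hsurj hγ hγᵥ y) ∉ IwasawaAlgebra.augIdealP 2) :
    ColemanMuSpanFreeIotaPosDiscAtTwo :=
  colemanMuSpanFreeIotaPosDiscAtTwo_of_tateDuality_of_muFreeValue hPT (muFreeValue_posDisc_of_ordKernel hOK hVflat)

/-- **The PAIR child `OrdKatoFineZetaAtTwoResidue` (stmt-BirchSwinnertonDyer-24097) BY NAME** from the two Literature facts (all `p`, read at
`2`), the value texts V♭⁻ and V♭⁺ (memo), Q⁺ = `FineSelmerConjATwoOrdPosDisc` (research: Coates–Sujatha (A) at `2` on the `0 < Δ` onto cell),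
Abbes–Ullmo and Kato 17.4 (1)(2) at `2` (print) — through the lead g6's (ε) door `ordKatoFineZetaAtTwoResidue_of_negDisc_of_epsilon`
(p700774). CONDITIONAL on the displayed OPEN statements; nothing closed. [cite: Kato2004Asterisque, Thm 17.4 (1)(2) (p. 273), §17.13 (pp. 279–280)]
[cite: CoatesSujatha2005, Conj. A (shape)] [cite: AbbesUllmo1996, Thm. A] [cite: PerrinRiou2000JAMS, §1.1 (p. 537)] -/
theorem ordKatoFineZetaAtTwoResidue_of_tateDuality_of_ordKernel_of_muFreeValues_of_conjA_of_print
    (hPT : exists_lambdaAdicLocalTatePairing_selmer_orthogonal) (hOK : exists_ordinaryKernelFunctional)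
    (hVneg : ∀ (W : WeierstrassCurve ℚ) [W.IsElliptic] [W.IsGloballyMinimal]
      [ContinuousSMul ℤ_[2] (W.tateModule 2)] [Module.Free ℤ_[2] (W.tateModule 2)] [Module.Finite ℤ_[2] (W.tateModule 2)]
      {N : ℕ} [NeZero N] (f : CuspForm (Gamma0 N) 2)
      (κ : ZpExtension ℚ 2) (γ : absoluteGaloisGroup ℚ) (hκ : κ.IsCyclotomic) (hγ : κ.IsTopGenerator γ),
      W.Δ < 0 → IsOrdinaryAt W 2 → W.HasSurjectiveModNGaloisRep 2 → IsCyclotomicVariable 2 γ → IsNewformOf W f →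
      ∀ (v₂ : HeightOneSpectrum (𝓞 ℚ)) (_ : ((2 : ℕ) : 𝓞 ℚ) ∈ v₂.asIdeal)
        (γᵥ : absoluteGaloisGroup (v₂.adicCompletion ℚ))
        (hsurj : Function.Surjective
          (κ.toContinuousMonoidHom.comp (resGalOfEmb (closureEmb (K := ℚ) (v₂.adicCompletion ℚ)))))
        (hγᵥ : κ.IsTopGenerator (resGalOfEmb (closureEmb (K := ℚ) (v₂.adicCompletion ℚ)) γᵥ))
        (I : IwasawaH1Data W 2 κ γ) (J : LocalIwasawaH1Data κ v₂ ((tateRep W 2).toLocal v₂) γᵥ)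
        (J' : LocalIwasawaH1Data κ v₂ (tateLocalOrdinaryRep W 2 v₂) γᵥ)
        (col : J.H →ₗ[IwasawaAlgebra 2] IwasawaAlgebra 2),
        (∀ x : J.H, col x = 0 ↔ x ∈ LinearMap.range (J'.ordinaryInclusion J)) →
        (∃ x : J.H, col x ∉ IwasawaAlgebra.augIdealP 2) →
        ∃ g : I.H, IsEulerSystemClassTwo W hκ I g ∧ col (I.loc J hsurj hγ hγᵥ g) ∉ IwasawaAlgebra.augIdealP 2)
    (hVpos : ∀ (W : WeierstrassCurve ℚ) [W.IsElliptic] [W.IsGloballyMinimal]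
      [ContinuousSMul ℤ_[2] (W.tateModule 2)] [Module.Free ℤ_[2] (W.tateModule 2)] [Module.Finite ℤ_[2] (W.tateModule 2)]
      {N : ℕ} [NeZero N] (f : CuspForm (Gamma0 N) 2)
      (κ : ZpExtension ℚ 2) (γ : absoluteGaloisGroup ℚ) (hκ : κ.IsCyclotomic) (hγ : κ.IsTopGenerator γ),
      0 < W.Δ → IsOrdinaryAt W 2 → W.HasSurjectiveModNGaloisRep 2 → IsCyclotomicVariable 2 γ → IsNewformOf W f →
      ∀ (v₂ : HeightOneSpectrum (𝓞 ℚ)) (_ : ((2 : ℕ) : 𝓞 ℚ) ∈ v₂.asIdeal)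
        (γᵥ : absoluteGaloisGroup (v₂.adicCompletion ℚ))
        (hsurj : Function.Surjective
          (κ.toContinuousMonoidHom.comp (resGalOfEmb (closureEmb (K := ℚ) (v₂.adicCompletion ℚ)))))
        (hγᵥ : κ.IsTopGenerator (resGalOfEmb (closureEmb (K := ℚ) (v₂.adicCompletion ℚ)) γᵥ))
        (I : IwasawaH1Data W 2 κ γ) (J : LocalIwasawaH1Data κ v₂ ((tateRep W 2).toLocal v₂) γᵥ)
        (J' : LocalIwasawaH1Data κ v₂ (tateLocalOrdinaryRep W 2 v₂) γᵥ)
        (col : J.H →ₗ[IwasawaAlgebra 2] IwasawaAlgebra 2),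
        (∀ x : J.H, col x = 0 ↔ x ∈ LinearMap.range (J'.ordinaryInclusion J)) →
        (∃ x : J.H, col x ∉ IwasawaAlgebra.augIdealP 2) →
        ∃ y : I.H, col (I.loc J hsurj hγ hγᵥ y) ∉ IwasawaAlgebra.augIdealP 2)
    (hQ : FineSelmerConjATwoOrdPosDisc) (hAU : abbesUllmo_not_dvd_maninConstant_of_not_dvd_level)
    (h17 : ∀ (V : WeierstrassCurve ℚ) [V.IsElliptic] [V.IsGloballyMinimal] [NeZero (V.conductorNorm ℤ)]
      (f : CuspForm (Gamma0 (V.conductorNorm ℤ)) 2), kato_divisibility_allPrimes V 2 (f := f)) :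
    OrdKatoFineZetaAtTwoResidue :=
  ordKatoFineZetaAtTwoResidue_of_negDisc_of_epsilon
    (zetaColemanMuIotaNegDiscAtTwo_of_tateDuality_of_ordKernel_of_muFreeValue hPT hOK hVneg)
    (colemanMuSpanFreeIotaPosDiscAtTwo_of_tateDuality_of_ordKernel_of_muFreeValue hPT hOK hVpos) hQ hAU h17

end Summit.BirchSwinnertonDyer.BirchSwinnertonDyer.Theorems.SteinbergFibreAtTwo

end
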